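import Summits.QuantumFields.YangMills.Theorems.ColdStartUniversalityFeynmanKacLezaudForm
import Summits.QuantumFields.YangMills.Theorems.ColdStartUniversalityLatticeLangevinWilsonReversibleMeasurable
import Summits.QuantumFields.YangMills.Theorems.ColdStartUniversalityLatticeLangevinMarkovProperty
import HarnessLib

/-!
# Route `ColdStartUniversality` (fixed-cut-off SZZ dynamics, sampler statistics): ★★★ THE DISCRETE FEYNMAN–KAC FUNCTIONAL OF THE
# `h`-SKELETON — `E[exp(θh Σ_{k≤n} V(U_{a+kh}))] ≤ D·e^{θhb}·m_h^n` from an `L²`-warm start and a spectral gap (Lezaud's mechanism)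

Helper file (seat `ym-line-csu-p1`, g37; `--supports stmt-QuantumFields-24809`).  SU(2) lattice Langevin dynamics of Shen–Zhu–Zhu at
`(L, β')`, Wilson measure `μ = μ_{β'}`, a realising Markov kernel family `κ`, strong solutions `U` from a deterministic start on ANY space.
The exponential moments of the skeleton sums are computed by the Feynman–Kac recursion `ψ_{n+1} = e^{θhV} · κ_h ψ_n` (Markov property),
symmetrised as `ψ_{n+1} = w · Sⁿ w` (`S f = w · κ_h(w f)`, `w = e^{θhV/2}`), whose `L²(μ)`-norm is controlled by its quadratic form
(`…FeynmanKacSandwich`), itself bounded through positivity `∫ G κ_h G dμ = ‖κ_{h/2}G‖²`, the gap, and `lezaud_form_bound`: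
* `integral_mul_transition_self_eq_sq_of_measurable`, `transition_form_le_of_gap` — positivity and the FORM-SENSE VARIANCE CONTRACTION
  `∫ G·κ_h G dμ ≤ (μG)² + e^{−λh} Var_μ(G)` for bounded measurable `G` from the `L²` decay `‖κ_t G − μG‖₂² ≤ e^{−2λt} Var_μ(G)`;
* ★★ `integral_mul_prod_skeleton_eq` — the FEYNMAN–KAC SKELETON FORMULA `E[Z · ∏_{k<n} φ(U_{a+kh})] = E[Z · ψ_n(U_a)]`,
  `ψ_n = (ψ ↦ φ · κ_h ψ)ⁿ 1`, every `𝓕_a`-measurable bounded `Z`, every bounded measurable `φ`; `skeleton_iterate_eq_sandwich`;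
* ★★★ `integral_exp_skeleton_sum_le` — gap `λ` (hypothesis, shape of `wilson_spectralGap_uniform_measurable`) + `L²`-WARM law at time `a`
  (`|E φ(U_a)| ≤ D‖φ‖_{L²(μ)}`), `|V| ≤ b`, `μV = 0`, `∫V² dμ ≤ σ²`, `0 ≤ θ`, `θhb ≤ 1`, `c_h = 1 − e^{−λh} − e^{−λh}θhb > 0` ⇒
  `E[exp(θh Σ_{k<n+1} V(U_{a+kh}))] ≤ D · e^{θhb} · m_hⁿ`, `m_h = 1 + e^{−2λh}θ²h²σ²/c_h + e^{−λh}(θhb)² + 3(1 − e^{−λh})θhb`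
  (`= 1 + h·θ²σ²/(λ − θb) + O(h²)` by `lezaud_rate_bound`).
[cite: Lezaud2001, Theorem 1.1 and Remark 1.2 (proof, §4)].  THEOREMS ONLY, no definition, no sorry.  HONEST FRAMING: fixed cut-off; `λ` and
`D` are HYPOTHESES here (discharged at `|β'| < 1/12`, `λ = 1 − 12|β'|`, `D = e` after the `O(log L)` burn-in, in the sequel); nothing is
uniform in the route's scaling; no crux, rung or summit statement is proved; the Yang–Mills mass gap is NOT proved.
-/

set_option autoImplicit false

noncomputable section

namespace Summit.QuantumFields.YangMills.Theorems.ColdStartUniversality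

open MeasureTheory ProbabilityTheory Filter Set
open scoped BigOperators NNReal ENNReal
open Literature.Probability.Process Literature.MathematicalPhysics.QuantumFieldTheory
open Literature.MathematicalPhysics.QuantumLattice (fundamentalRep fundamentalLatticeRep continuous_fundamentalRep)

variable {L : ℕ} [NeZero L]

/-! ## §1. Positivity and the form-sense variance contraction from the gap -/

/-- **Positivity identity on bounded measurable observables**: `∫ G · κ_{s+s} G dμ_{β'} = ∫ (κ_s G)² dμ_{β'}` (Chapman–Kolmogorov and
detailed balance `integral_mul_transition_symm_su2_of_measurable`). [cite: ShenZhuZhu2022, §3 (p. 13)] -/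
theorem integral_mul_transition_self_eq_sq_of_measurable (L : ℕ) [NeZero L] (β' : ℝ)
    (κ : ℝ≥0 → Kernel (GaugeConfig 3 L (Matrix.specialUnitaryGroup (Fin 2) ℂ))
      (GaugeConfig 3 L (Matrix.specialUnitaryGroup (Fin 2) ℂ))) [∀ t, IsMarkovKernel (κ t)]
    (hreal : ∀ (t : ℝ≥0) (x : GaugeConfig 3 L (Matrix.specialUnitaryGroup (Fin 2) ℂ))
        (Ω : Type) [MeasurableSpace Ω] (P : Measure Ω) [IsProbabilityMeasure P]
        (W : ℝ≥0 → Ω → (Edge 3 L × NoiseIdx 2 → ℝ)) (hW : IsFlatBrownian W P)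
        (U : ℝ≥0 → Ω → GaugeConfig 3 L (Matrix.specialUnitaryGroup (Fin 2) ℂ)),
        (∀ ω, U 0 ω = x) →
        (latticeLangevinDynamics (fundamentalLatticeRep 2) β').IsSolution (fundamentalRep (Fin 2))
          hW.natFiltration P W U →
        κ t x = P.map (U t))
    (s : ℝ≥0) {G : GaugeConfig 3 L (Matrix.specialUnitaryGroup (Fin 2) ℂ) → ℝ} (hG : Measurable G) {M : ℝ} (hGM : ∀ x, |G x| ≤ M) :
    ∫ x, G x * (∫ y, G y ∂(κ (s + s) x)) ∂(wilsonMeasure (d := 3) (L := L) (fundamentalRep (Fin 2)) β') =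
      ∫ x, (∫ y, G y ∂(κ s x)) ^ 2 ∂(wilsonMeasure (d := 3) (L := L) (fundamentalRep (Fin 2)) β') := by
  classical
  have hCK : κ (s + s) = κ s ∘ₖ κ s := chapmanKolmogorov_szz β' κ hreal s s
  have hPG : Measurable fun y => ∫ z, G z ∂(κ s y) := FeynmanKac.measurable_kernel_integral (κ s) hG
  have hPGb : ∀ y, |∫ z, G z ∂(κ s y)| ≤ M := fun y => FeynmanKac.abs_kernel_integral_le (κ s) hGM y
  have e1 : ∀ x, ∫ y, G y ∂(κ (s + s) x) = ∫ y, (∫ z, G z ∂(κ s y)) ∂(κ s x) := by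
    intro x
    haveI : IsProbabilityMeasure ((κ s ∘ₖ κ s) x) := by rw [← hCK]; infer_instance
    rw [hCK]
    exact Kernel.integral_comp (FeynmanKac.integrable_of_measurable_of_abs_le _ hG hGM)
  simp_rw [e1]
  rw [integral_mul_transition_symm_su2_of_measurable L β' κ hreal s hG ⟨M, hGM⟩ hPG ⟨M, hPGb⟩]
  exact integral_congr_ae (Eventually.of_forall fun x => by dsimp only; rw [sq])

/-- **Form-sense variance contraction from the `L²` gap.**  If `∫ (κ_t G − μG)² dμ_{β'} ≤ e^{−2λt} Var_{μ_{β'}}(G)` for all bounded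
measurable `G` and all `t` (the shape of `wilson_spectralGap_uniform_measurable` / `wilson_spectralGap_explicit`), then for every bounded
measurable `G` and every `h`:  `∫ G · κ_h G dμ_{β'} ≤ (∫ G dμ_{β'})² + e^{−λh} (∫ G² dμ_{β'} − (∫ G dμ_{β'})²)`
(`κ_h = κ_{h/2}κ_{h/2}`, positivity, invariance). [cite: Lezaud2001, §4] -/
theorem transition_form_le_of_gap (L : ℕ) [NeZero L] (β' : ℝ)
    (κ : ℝ≥0 → Kernel (GaugeConfig 3 L (Matrix.specialUnitaryGroup (Fin 2) ℂ))
      (GaugeConfig 3 L (Matrix.specialUnitaryGroup (Fin 2) ℂ))) [∀ t, IsMarkovKernel (κ t)]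
    (hreal : ∀ (t : ℝ≥0) (x : GaugeConfig 3 L (Matrix.specialUnitaryGroup (Fin 2) ℂ))
        (Ω : Type) [MeasurableSpace Ω] (P : Measure Ω) [IsProbabilityMeasure P]
        (W : ℝ≥0 → Ω → (Edge 3 L × NoiseIdx 2 → ℝ)) (hW : IsFlatBrownian W P)
        (U : ℝ≥0 → Ω → GaugeConfig 3 L (Matrix.specialUnitaryGroup (Fin 2) ℂ)),
        (∀ ω, U 0 ω = x) →
        (latticeLangevinDynamics (fundamentalLatticeRep 2) β').IsSolution (fundamentalRep (Fin 2))
          hW.natFiltration P W U →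
        κ t x = P.map (U t))
    {lam : ℝ}
    (hgap : ∀ {G : GaugeConfig 3 L (Matrix.specialUnitaryGroup (Fin 2) ℂ) → ℝ}, Measurable G → ∀ {M : ℝ}, (∀ x, |G x| ≤ M) →
      ∀ t : ℝ≥0, ∫ x, ((∫ y, G y ∂(κ t x)) - ∫ z, G z ∂(wilsonMeasure (d := 3) (L := L) (fundamentalRep (Fin 2)) β')) ^ 2
          ∂(wilsonMeasure (d := 3) (L := L) (fundamentalRep (Fin 2)) β') ≤
        Real.exp (-2 * lam * t) * ∫ x, (G x - ∫ z, G z ∂(wilsonMeasure (d := 3) (L := L) (fundamentalRep (Fin 2)) β')) ^ 2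
          ∂(wilsonMeasure (d := 3) (L := L) (fundamentalRep (Fin 2)) β'))
    {G : GaugeConfig 3 L (Matrix.specialUnitaryGroup (Fin 2) ℂ) → ℝ} (hG : Measurable G) {M : ℝ} (hGM : ∀ x, |G x| ≤ M)
    (h : ℝ≥0) :
    ∫ x, G x * (∫ y, G y ∂(κ h x)) ∂(wilsonMeasure (d := 3) (L := L) (fundamentalRep (Fin 2)) β') ≤
      (∫ x, G x ∂(wilsonMeasure (d := 3) (L := L) (fundamentalRep (Fin 2)) β')) ^ 2 +
        Real.exp (-(lam * h)) *
          ((∫ x, G x ^ 2 ∂(wilsonMeasure (d := 3) (L := L) (fundamentalRep (Fin 2)) β')) -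
            (∫ x, G x ∂(wilsonMeasure (d := 3) (L := L) (fundamentalRep (Fin 2)) β')) ^ 2) := by
  classical
  set μ : Measure (GaugeConfig 3 L (Matrix.specialUnitaryGroup (Fin 2) ℂ)) :=
    wilsonMeasure (d := 3) (L := L) (fundamentalRep (Fin 2)) β' with hμ
  haveI : IsProbabilityMeasure μ :=
    isProbabilityMeasure_wilsonMeasure (d := 3) (L := L) (fundamentalRep (Fin 2)) (continuous_fundamentalRep (Fin 2)) β'
  set m : ℝ := ∫ x, G x ∂μ with hm
  have hs : h = h / 2 + h / 2 := (add_halves h).symm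
  have key : ∫ x, G x * (∫ y, G y ∂(κ h x)) ∂μ = ∫ x, (∫ y, G y ∂(κ (h / 2) x)) ^ 2 ∂μ := by
    conv_lhs => rw [hs]
    exact integral_mul_transition_self_eq_sq_of_measurable L β' κ hreal (h / 2) hG hGM
  have hPG : Measurable fun y => ∫ z, G z ∂(κ (h / 2) y) := FeynmanKac.measurable_kernel_integral (κ (h / 2)) hG
  have hPGb : ∀ y, |∫ z, G z ∂(κ (h / 2) y)| ≤ M := fun y => FeynmanKac.abs_kernel_integral_le (κ (h / 2)) hGM y
  -- invariance: `∫ κ_{h/2} G dμ = m`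
  have hinv : ∫ x, (∫ y, G y ∂(κ (h / 2) x)) ∂μ = m :=
    integral_transitionKernel_integral_eq_wilson (L := L) β' κ hreal (h / 2) hG ⟨M, hGM⟩
  -- `∫ (κG)² = ∫ (κG − m)² + m²`
  have iPG : Integrable (fun x => ∫ y, G y ∂(κ (h / 2) x)) μ := FeynmanKac.integrable_of_measurable_of_abs_le μ hPG hPGb
  have iPG2 : Integrable (fun x => ((∫ y, G y ∂(κ (h / 2) x)) - m) ^ 2) μ :=
    FeynmanKac.integrable_of_measurable_of_abs_le μ ((hPG.sub measurable_const).pow_const 2) (B := (M + |m|) ^ 2) fun x => by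
      rw [abs_pow]; exact pow_le_pow_left₀ (abs_nonneg _) ((abs_sub _ _).trans (add_le_add (hPGb x) le_rfl)) 2
  have hdec : ∫ x, (∫ y, G y ∂(κ (h / 2) x)) ^ 2 ∂μ = (∫ x, ((∫ y, G y ∂(κ (h / 2) x)) - m) ^ 2 ∂μ) + m ^ 2 := by
    have hfun : (fun x => (∫ y, G y ∂(κ (h / 2) x)) ^ 2) =
        fun x => (((∫ y, G y ∂(κ (h / 2) x)) - m) ^ 2 + (2 * m) * (∫ y, G y ∂(κ (h / 2) x))) + (-(m ^ 2)) := by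
      funext x; ring
    have i12 : Integrable (fun x => ((∫ y, G y ∂(κ (h / 2) x)) - m) ^ 2 + (2 * m) * (∫ y, G y ∂(κ (h / 2) x))) μ :=
      iPG2.add (iPG.const_mul _)
    rw [hfun, integral_add i12 (integrable_const _), integral_add iPG2 (iPG.const_mul _),
      integral_const_mul, hinv, integral_const, probReal_univ, one_smul]
    ring
  -- the gap at time `h/2` and `∫ (G − m)² = ∫ G² − m²`
  have iG : Integrable G μ := FeynmanKac.integrable_of_measurable_of_abs_le μ hG hGM
  have iG2 : Integrable (fun x => G x ^ 2) μ :=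
    FeynmanKac.integrable_of_measurable_of_abs_le μ (hG.pow_const 2) (B := M ^ 2) fun x => by
      rw [abs_pow]; exact pow_le_pow_left₀ (abs_nonneg _) (hGM x) 2
  have hvar : ∫ x, (G x - m) ^ 2 ∂μ = (∫ x, G x ^ 2 ∂μ) - m ^ 2 := by
    have hfun : (fun x => (G x - m) ^ 2) = fun x => (G x ^ 2 - (2 * m) * G x) + m ^ 2 := by funext x; ring
    have i12 : Integrable (fun x => G x ^ 2 - (2 * m) * G x) μ := iG2.sub (iG.const_mul _)
    rw [hfun, integral_add i12 (integrable_const _), integral_sub iG2 (iG.const_mul _), integral_const_mul,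
      ← hm, integral_const, probReal_univ, one_smul]
    ring
  have hg := hgap hG hGM (h / 2)
  have hrate : Real.exp (-2 * lam * ((h / 2 : ℝ≥0) : ℝ)) = Real.exp (-(lam * h)) := by congr 1; push_cast; ring
  rw [hrate, ← hm, hvar] at hg
  rw [key, hdec]
  linarith [hg]

/-! ## §2. The Feynman–Kac skeleton formula -/

/-- The Feynman–Kac iterates `ψ_n = (ψ ↦ φ · κψ)ⁿ 1` of a bounded measurable `φ` (`|φ| ≤ Φ`) under a Markov kernel are measurable with
`|ψ_n| ≤ Φⁿ`. [folklore] -/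
theorem feynmanKac_iterate_measurable_abs_le {X : Type*} [MeasurableSpace X] (Q : Kernel X X) [IsMarkovKernel Q]
    {φ : X → ℝ} (hφ : Measurable φ) {Φ : ℝ} (hΦ : ∀ z, |φ z| ≤ Φ) (n : ℕ) :
    Measurable ((fun (ψ : X → ℝ) (z : X) => φ z * ∫ y, ψ y ∂(Q z))^[n] fun _ => 1) ∧
      ∀ z, |((fun (ψ : X → ℝ) (z : X) => φ z * ∫ y, ψ y ∂(Q z))^[n] fun _ => 1) z| ≤ Φ ^ n := by
  induction n with
  | zero => exact ⟨measurable_const, fun z => by simp⟩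
  | succ n ih =>
    obtain ⟨hmn, hbn⟩ := ih
    refine ⟨?_, fun z => ?_⟩
    · rw [Function.iterate_succ_apply']
      exact hφ.mul (FeynmanKac.measurable_kernel_integral Q hmn)
    · rw [Function.iterate_succ_apply', pow_succ, mul_comm (Φ ^ n)]
      exact FeynmanKac.abs_mul_le_of_abs_le hΦ (fun z => FeynmanKac.abs_kernel_integral_le Q hbn z) z

/-- ★★ **THE FEYNMAN–KAC SKELETON FORMULA.**  For every realising Markov kernel family `κ` of the SZZ dynamics, EVERY strong solution `U`
from a deterministic start on ANY probability space, every bounded measurable `φ`, all lattice times `a, h`, every `n`, and every bounded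
`Z` measurable for `σ(W_u : u ≤ a)`:  `∫ Z · ∏_{k<n} φ(U_{a+kh}) dP = ∫ Z · ψ_n(U_a) dP` with `ψ_n = (ψ ↦ φ · κ_h ψ)ⁿ 1`
(backward induction on the Markov property `integral_mul_comp_add_eq_integral_mul_transition`). [cite: RevuzYor1999, Ch. III Prop. (1.7)] -/
theorem integral_mul_prod_skeleton_eq (β' : ℝ)
    (κ : ℝ≥0 → Kernel (GaugeConfig 3 L (Matrix.specialUnitaryGroup (Fin 2) ℂ))
      (GaugeConfig 3 L (Matrix.specialUnitaryGroup (Fin 2) ℂ))) [∀ t, IsMarkovKernel (κ t)]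
    (hreal : ∀ (t : ℝ≥0) (x : GaugeConfig 3 L (Matrix.specialUnitaryGroup (Fin 2) ℂ))
        (Ω : Type) [MeasurableSpace Ω] (P : Measure Ω) [IsProbabilityMeasure P]
        (W : ℝ≥0 → Ω → (Edge 3 L × NoiseIdx 2 → ℝ)) (hW : IsFlatBrownian W P)
        (U : ℝ≥0 → Ω → GaugeConfig 3 L (Matrix.specialUnitaryGroup (Fin 2) ℂ)),
        (∀ ω, U 0 ω = x) →
        (latticeLangevinDynamics (fundamentalLatticeRep 2) β').IsSolution (fundamentalRep (Fin 2))
          hW.natFiltration P W U →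
        κ t x = P.map (U t))
    (x : GaugeConfig 3 L (Matrix.specialUnitaryGroup (Fin 2) ℂ))
    {Ω : Type} [MeasurableSpace Ω] {P : Measure Ω} [IsProbabilityMeasure P]
    {W : ℝ≥0 → Ω → (Edge 3 L × NoiseIdx 2 → ℝ)} (hW : IsFlatBrownian W P)
    {U : ℝ≥0 → Ω → GaugeConfig 3 L (Matrix.specialUnitaryGroup (Fin 2) ℂ)} (hU0 : ∀ ω, U 0 ω = x)
    (hU : (latticeLangevinDynamics (fundamentalLatticeRep 2) β').IsSolution (fundamentalRep (Fin 2)) hW.natFiltration P W U)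
    {φ : GaugeConfig 3 L (Matrix.specialUnitaryGroup (Fin 2) ℂ) → ℝ} (hφ : Measurable φ) {Φ : ℝ} (hΦ : ∀ z, |φ z| ≤ Φ)
    (h : ℝ≥0) (n : ℕ) (a : ℝ≥0) {Z : Ω → ℝ} (hZ : Measurable[hW.natFiltration a] Z) {CZ : ℝ} (hZb : ∀ ω, |Z ω| ≤ CZ) :
    ∫ ω, Z ω * ∏ k ∈ Finset.range n, φ (U (a + (k : ℝ≥0) * h) ω) ∂P =
      ∫ ω, Z ω * ((fun (ψ : GaugeConfig 3 L (Matrix.specialUnitaryGroup (Fin 2) ℂ) → ℝ)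
        (z : GaugeConfig 3 L (Matrix.specialUnitaryGroup (Fin 2) ℂ)) => φ z * ∫ y, ψ y ∂(κ h z))^[n] fun _ => 1) (U a ω) ∂P := by
  induction n generalizing a Z CZ with
  | zero => simp
  | succ n ih =>
    have hmU : ∀ u : ℝ≥0, Measurable (U u) := fun u => (hU.adapted u).mono (hW.natFiltration.le u) le_rfl
    -- split off the factor `k = 0`
    have hsplit : ∀ ω, Z ω * ∏ k ∈ Finset.range (n + 1), φ (U (a + (k : ℝ≥0) * h) ω) =
        (Z ω * φ (U a ω)) * ∏ k ∈ Finset.range n, φ (U ((a + h) + (k : ℝ≥0) * h) ω) := by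
      intro ω
      rw [Finset.prod_range_succ']
      have e0 : a + ((0 : ℕ) : ℝ≥0) * h = a := by simp
      have ek : ∀ k : ℕ, a + ((k + 1 : ℕ) : ℝ≥0) * h = (a + h) + (k : ℝ≥0) * h := fun k => by push_cast; ring
      simp only [e0, ek]
      ring
    -- the weight `Z · φ(U_a)` is `𝓕_{a+h}`-measurable and bounded
    have hZa : Measurable[hW.natFiltration a] fun ω => Z ω * φ (U a ω) := hZ.mul (hφ.comp (hU.adapted a))
    have hZ' : Measurable[hW.natFiltration (a + h)] fun ω => Z ω * φ (U a ω) :=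
      hZa.mono (hW.natFiltration.mono le_self_add) le_rfl
    have hZ'b : ∀ ω, |Z ω * φ (U a ω)| ≤ CZ * Φ := fun ω => FeynmanKac.abs_mul_le_of_abs_le hZb (fun ω => hΦ (U a ω)) ω
    obtain ⟨hmn, hbn⟩ := feynmanKac_iterate_measurable_abs_le (κ h) hφ hΦ n
    calc ∫ ω, Z ω * ∏ k ∈ Finset.range (n + 1), φ (U (a + (k : ℝ≥0) * h) ω) ∂P
        = ∫ ω, (Z ω * φ (U a ω)) * ∏ k ∈ Finset.range n, φ (U ((a + h) + (k : ℝ≥0) * h) ω) ∂P :=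
          integral_congr_ae (ae_of_all _ fun ω => hsplit ω)
      _ = ∫ ω, (Z ω * φ (U a ω)) * ((fun (ψ : GaugeConfig 3 L (Matrix.specialUnitaryGroup (Fin 2) ℂ) → ℝ)
            (z : GaugeConfig 3 L (Matrix.specialUnitaryGroup (Fin 2) ℂ)) => φ z * ∫ y, ψ y ∂(κ h z))^[n] fun _ => 1)
            (U (a + h) ω) ∂P := ih (a + h) hZ' hZ'b
      _ = ∫ ω, (Z ω * φ (U a ω)) * (∫ y, ((fun (ψ : GaugeConfig 3 L (Matrix.specialUnitaryGroup (Fin 2) ℂ) → ℝ)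
            (z : GaugeConfig 3 L (Matrix.specialUnitaryGroup (Fin 2) ℂ)) => φ z * ∫ y, ψ y ∂(κ h z))^[n] fun _ => 1) y
            ∂(κ h (U a ω))) ∂P :=
          integral_mul_comp_add_eq_integral_mul_transition β' κ hreal x hW hU0 hU a h hZa hZ'b hmn hbn
      _ = ∫ ω, Z ω * ((fun (ψ : GaugeConfig 3 L (Matrix.specialUnitaryGroup (Fin 2) ℂ) → ℝ)
            (z : GaugeConfig 3 L (Matrix.specialUnitaryGroup (Fin 2) ℂ)) => φ z * ∫ y, ψ y ∂(κ h z))^[n + 1] fun _ => 1)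
            (U a ω) ∂P := by
          refine integral_congr_ae (ae_of_all _ fun ω => ?_)
          rw [Function.iterate_succ_apply']
          ring

/-- `(ψ ↦ w²·Qψ)^{n+1} 1 = w · (f ↦ w·Q(wf))ⁿ w` for a Markov kernel `Q`: the Feynman–Kac iterates of the weight `φ = w²` are the
symmetric sandwich iterates of `w`, multiplied by `w`. [folklore] -/
theorem skeleton_iterate_eq_sandwich {X : Type*} [MeasurableSpace X] (Q : Kernel X X) [IsMarkovKernel Q] (w : X → ℝ) (n : ℕ) :
    ((fun (ψ : X → ℝ) (z : X) => (w z * w z) * ∫ y, ψ y ∂(Q z))^[n + 1] fun _ => 1) =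
      fun z => w z * ((fun (f : X → ℝ) (z : X) => w z * ∫ y, w y * f y ∂(Q z))^[n] w) z := by
  induction n with
  | zero => funext z; simp
  | succ n ih =>
    rw [Function.iterate_succ_apply', ih]; funext z; rw [Function.iterate_succ_apply']; ring

/-! ## §3. The exponential moment of the skeleton sum -/

/-- ★★★ **DISCRETE FEYNMAN–KAC BOUND (Lezaud's mechanism along the `h`-skeleton).**  Let `κ` be a realising Markov kernel family of the
SU(2) SZZ dynamics at `(L, β')` with an `L²(μ_{β'})` GAP `λ > 0` on bounded measurable observables
(`∫ (κ_t G − μG)² dμ ≤ e^{−2λt} Var_μ(G)`), `U` a strong solution from a deterministic start on ANY space whose law at the lattice time `a`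
is `L²`-WARM: `|∫ φ(U_a) dP| ≤ D (∫ φ² dμ)^{1/2}` for all bounded measurable `φ`.  Let `V` be measurable with `|V| ≤ b`, `∫ V dμ = 0`,
`∫ V² dμ ≤ σ²` (`σ > 0`), `0 ≤ θ`, and `h > 0` a step with `θhb ≤ 1` and `c_h = 1 − e^{−λh} − e^{−λh}·θhb > 0`.  Then for every `n`

  `∫ exp(θh · Σ_{k<n+1} V(U_{a+kh})) dP ≤ D · e^{θhb} · m_hⁿ`,
  `m_h = 1 + (e^{−λh})²(θh)²σ²/c_h + e^{−λh}(θhb)² + 3(1 − e^{−λh})(θhb)`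

(Feynman–Kac skeleton formula, `ψ_{n+1} = w·Sⁿw`, warm start, `‖Sⁿw‖₂ ≤ m_hⁿ‖w‖₂` by norm-from-form with the form bounded through
positivity + gap + `lezaud_form_bound`).  By `lezaud_rate_bound`, `m_h ≤ 1 + hθ²σ²/(λ − θb) + O(h²)`, so with `T = nh` the bound is
`D·exp(T·θ²σ²/(λ − θb) + o(1))` — Lezaud's Chernoff bound with the variance proxy `σ²`. [cite: Lezaud2001, Theorem 1.1 and Remark 1.2] -/
theorem integral_exp_skeleton_sum_le (L : ℕ) [NeZero L] (β' : ℝ)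
    (κ : ℝ≥0 → Kernel (GaugeConfig 3 L (Matrix.specialUnitaryGroup (Fin 2) ℂ))
      (GaugeConfig 3 L (Matrix.specialUnitaryGroup (Fin 2) ℂ))) [∀ t, IsMarkovKernel (κ t)]
    (hreal : ∀ (t : ℝ≥0) (x : GaugeConfig 3 L (Matrix.specialUnitaryGroup (Fin 2) ℂ))
        (Ω : Type) [MeasurableSpace Ω] (P : Measure Ω) [IsProbabilityMeasure P]
        (W : ℝ≥0 → Ω → (Edge 3 L × NoiseIdx 2 → ℝ)) (hW : IsFlatBrownian W P)
        (U : ℝ≥0 → Ω → GaugeConfig 3 L (Matrix.specialUnitaryGroup (Fin 2) ℂ)),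
        (∀ ω, U 0 ω = x) →
        (latticeLangevinDynamics (fundamentalLatticeRep 2) β').IsSolution (fundamentalRep (Fin 2))
          hW.natFiltration P W U →
        κ t x = P.map (U t))
    {lam : ℝ} (hlam : 0 < lam)
    (hgap : ∀ {G : GaugeConfig 3 L (Matrix.specialUnitaryGroup (Fin 2) ℂ) → ℝ}, Measurable G → ∀ {M : ℝ}, (∀ x, |G x| ≤ M) →
      ∀ t : ℝ≥0, ∫ x, ((∫ y, G y ∂(κ t x)) - ∫ z, G z ∂(wilsonMeasure (d := 3) (L := L) (fundamentalRep (Fin 2)) β')) ^ 2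
          ∂(wilsonMeasure (d := 3) (L := L) (fundamentalRep (Fin 2)) β') ≤
        Real.exp (-2 * lam * t) * ∫ x, (G x - ∫ z, G z ∂(wilsonMeasure (d := 3) (L := L) (fundamentalRep (Fin 2)) β')) ^ 2
          ∂(wilsonMeasure (d := 3) (L := L) (fundamentalRep (Fin 2)) β'))
    (x : GaugeConfig 3 L (Matrix.specialUnitaryGroup (Fin 2) ℂ))
    {Ω : Type} [MeasurableSpace Ω] {P : Measure Ω} [IsProbabilityMeasure P]
    {W : ℝ≥0 → Ω → (Edge 3 L × NoiseIdx 2 → ℝ)} (hW : IsFlatBrownian W P)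
    {U : ℝ≥0 → Ω → GaugeConfig 3 L (Matrix.specialUnitaryGroup (Fin 2) ℂ)} (hU0 : ∀ ω, U 0 ω = x)
    (hU : (latticeLangevinDynamics (fundamentalLatticeRep 2) β').IsSolution (fundamentalRep (Fin 2)) hW.natFiltration P W U)
    (a : ℝ≥0) {D : ℝ} (hD : 0 ≤ D)
    (hwarm : ∀ {φ : GaugeConfig 3 L (Matrix.specialUnitaryGroup (Fin 2) ℂ) → ℝ}, Measurable φ → ∀ {M : ℝ}, (∀ z, |φ z| ≤ M) →
      |∫ ω, φ (U a ω) ∂P| ≤ D * (∫ z, φ z ^ 2 ∂(wilsonMeasure (d := 3) (L := L) (fundamentalRep (Fin 2)) β')) ^ (1 / (2 : ℝ)))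
    {V : GaugeConfig 3 L (Matrix.specialUnitaryGroup (Fin 2) ℂ) → ℝ} (hV : Measurable V) {b σ : ℝ} (hb : 0 ≤ b)
    (hVb : ∀ z, |V z| ≤ b) (hσ : 0 < σ) (hV0 : ∫ z, V z ∂(wilsonMeasure (d := 3) (L := L) (fundamentalRep (Fin 2)) β') = 0)
    (hV2 : ∫ z, V z ^ 2 ∂(wilsonMeasure (d := 3) (L := L) (fundamentalRep (Fin 2)) β') ≤ σ ^ 2)
    {θ : ℝ} (hθ : 0 ≤ θ) (h : ℝ≥0) (hh : 0 < (h : ℝ)) (hθhb : θ * h * b ≤ 1)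
    (hc : 0 < 1 - Real.exp (-(lam * h)) - Real.exp (-(lam * h)) * (θ * h * b)) (n : ℕ) :
    ∫ ω, Real.exp (θ * h * ∑ k ∈ Finset.range (n + 1), V (U (a + (k : ℝ≥0) * h) ω)) ∂P ≤
      D * Real.exp (θ * h * b) *
        (1 + Real.exp (-(lam * h)) ^ 2 * (θ * h) ^ 2 * σ ^ 2 / (1 - Real.exp (-(lam * h)) - Real.exp (-(lam * h)) * (θ * h * b)) +
          Real.exp (-(lam * h)) * (θ * h * b) ^ 2 + 3 * (1 - Real.exp (-(lam * h))) * (θ * h * b)) ^ n := by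
  classical
  set μ : Measure (GaugeConfig 3 L (Matrix.specialUnitaryGroup (Fin 2) ℂ)) :=
    wilsonMeasure (d := 3) (L := L) (fundamentalRep (Fin 2)) β' with hμ
  haveI : IsProbabilityMeasure μ :=
    isProbabilityMeasure_wilsonMeasure (d := 3) (L := L) (fundamentalRep (Fin 2)) (continuous_fundamentalRep (Fin 2)) β'
  set r : ℝ := Real.exp (-(lam * h)) with hr
  set ε : ℝ := θ * h with hε
  set m : ℝ := 1 + r ^ 2 * ε ^ 2 * σ ^ 2 / (1 - r - r * (ε * b)) + r * (ε * b) ^ 2 + 3 * (1 - r) * (ε * b) with hmdef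
  have hr0 : 0 ≤ r := (Real.exp_pos _).le
  have hr1 : r ≤ 1 := by rw [hr]; exact Real.exp_le_one_iff.2 (by have := hlam.le; nlinarith [h.coe_nonneg])
  have hε0 : 0 ≤ ε := mul_nonneg hθ h.coe_nonneg
  have hεb : ε * b ≤ 1 := by rw [hε]; exact hθhb
  have hεb0 : 0 ≤ ε * b := mul_nonneg hε0 hb
  have hc' : 0 < 1 - r - r * (ε * b) := by rw [hr, hε]; exact hc
  have hm1 : 1 ≤ m := by
    rw [hmdef]
    have : 0 ≤ r ^ 2 * ε ^ 2 * σ ^ 2 / (1 - r - r * (ε * b)) := by positivity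
    nlinarith [mul_nonneg hr0 (sq_nonneg (ε * b)), mul_nonneg (by linarith : 0 ≤ 1 - r) hεb0]
  have hm0 : 0 ≤ m := by linarith
  -- the weights `w = e^{εV/2}`, `φ = w² = e^{εV}`
  set w : GaugeConfig 3 L (Matrix.specialUnitaryGroup (Fin 2) ℂ) → ℝ := fun z => Real.exp (ε * V z / 2) with hw
  have hεV : ∀ z, |ε * V z| ≤ ε * b := fun z => by
    rw [abs_mul, abs_of_nonneg hε0]; exact mul_le_mul_of_nonneg_left (hVb z) hε0
  have hwm : Measurable w := Real.measurable_exp.comp ((hV.const_mul ε).div_const 2)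
  have hwpos : ∀ z, 0 < w z := fun z => Real.exp_pos _
  have hwb : ∀ z, |w z| ≤ Real.exp (ε * b / 2) := fun z => by
    rw [hw, abs_of_pos (Real.exp_pos _)]
    exact Real.exp_le_exp.2 (by linarith [(abs_le.1 (hεV z)).2])
  have hww : ∀ z, w z * w z = Real.exp (ε * V z) := fun z => by rw [hw, ← Real.exp_add]; congr 1; ring
  have hφm : Measurable fun z => w z * w z := hwm.mul hwm
  have hφb : ∀ z, |w z * w z| ≤ Real.exp (ε * b) := fun z => by
    rw [hww, abs_of_pos (Real.exp_pos _)]; exact Real.exp_le_exp.2 (le_abs_self _ |>.trans (hεV z))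
  -- step 1: `exp(θh Σ V) = ∏ φ(U_{a+kh})` and the skeleton formula with `Z = 1`
  have hexp : ∀ ω, Real.exp (θ * h * ∑ k ∈ Finset.range (n + 1), V (U (a + (k : ℝ≥0) * h) ω)) =
      ∏ k ∈ Finset.range (n + 1), (w (U (a + (k : ℝ≥0) * h) ω) * w (U (a + (k : ℝ≥0) * h) ω)) := fun ω => by
    rw [Finset.mul_sum, Real.exp_sum]
    exact Finset.prod_congr rfl fun k _ => by rw [hww]
  have hskel := integral_mul_prod_skeleton_eq (L := L) β' κ hreal x hW hU0 hU hφm hφb h (n + 1) a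
    (measurable_const (a := (1 : ℝ))) (CZ := 1) (fun _ => by simp)
  simp only [one_mul] at hskel
  rw [show (fun ω => Real.exp (θ * h * ∑ k ∈ Finset.range (n + 1), V (U (a + (k : ℝ≥0) * h) ω))) =
      fun ω => ∏ k ∈ Finset.range (n + 1), (w (U (a + (k : ℝ≥0) * h) ω) * w (U (a + (k : ℝ≥0) * h) ω)) from funext hexp, hskel,
    skeleton_iterate_eq_sandwich (κ h) w n]
  -- step 2: the iterate `Sⁿ w` is bounded measurable; warm start on `ψ = w · Sⁿw`
  obtain ⟨hSm, hSb⟩ := FeynmanKac.sandwich_iterate_measurable_abs_le (κ h) hwm hwb hwm hwb n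
  set Sw := (fun (f : GaugeConfig 3 L (Matrix.specialUnitaryGroup (Fin 2) ℂ) → ℝ)
    (z : GaugeConfig 3 L (Matrix.specialUnitaryGroup (Fin 2) ℂ)) => w z * ∫ y, w y * f y ∂(κ h z))^[n] w with hSw
  have hψm : Measurable fun z => w z * Sw z := hwm.mul hSm
  have hψb : ∀ z, |w z * Sw z| ≤ Real.exp (ε * b / 2) * ((Real.exp (ε * b / 2) * Real.exp (ε * b / 2)) ^ n * Real.exp (ε * b / 2)) :=
    FeynmanKac.abs_mul_le_of_abs_le hwb hSb
  have hwarmψ := hwarm hψm hψb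
  -- step 3: `∫ (w·Sⁿw)² dμ ≤ e^{εb} ∫ (Sⁿw)² ≤ e^{εb} m^{2n} ∫ w² ≤ (e^{εb} mⁿ)²`
  have hSym : ∀ {f g : GaugeConfig 3 L (Matrix.specialUnitaryGroup (Fin 2) ℂ) → ℝ}, Measurable f → (∃ C : ℝ, ∀ x, |f x| ≤ C) →
      Measurable g → (∃ C : ℝ, ∀ x, |g x| ≤ C) →
      ∫ x, f x * (∫ y, g y ∂(κ h x)) ∂μ = ∫ x, g x * (∫ y, f y ∂(κ h x)) ∂μ :=
    fun hf hfb hg hgb => integral_mul_transition_symm_su2_of_measurable L β' κ hreal h hf hfb hg hgb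
  have hPos : ∀ {g : GaugeConfig 3 L (Matrix.specialUnitaryGroup (Fin 2) ℂ) → ℝ}, Measurable g → (∃ C : ℝ, ∀ x, |g x| ≤ C) →
      0 ≤ ∫ x, g x * (∫ y, g y ∂(κ h x)) ∂μ := by
    intro g hg hgb
    obtain ⟨C, hC⟩ := hgb
    rw [show h = h / 2 + h / 2 from (add_halves h).symm, integral_mul_transition_self_eq_sq_of_measurable L β' κ hreal (h / 2) hg hC]
    exact integral_nonneg fun x => sq_nonneg _
  have hForm : ∀ {g : GaugeConfig 3 L (Matrix.specialUnitaryGroup (Fin 2) ℂ) → ℝ}, Measurable g → (∃ C : ℝ, ∀ x, |g x| ≤ C) →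
      ∫ x, (w x * g x) * (∫ y, w y * g y ∂(κ h x)) ∂μ ≤ m * ∫ x, g x ^ 2 ∂μ := by
    intro g hg hgb
    obtain ⟨C, hC⟩ := hgb
    have hwg : Measurable fun z => w z * g z := hwm.mul hg
    have hwgb : ∀ z, |w z * g z| ≤ Real.exp (ε * b / 2) * C := FeynmanKac.abs_mul_le_of_abs_le hwb hC
    have h1 := transition_form_le_of_gap L β' κ hreal hgap hwg hwgb h
    have h2 := FeynmanKac.lezaud_form_bound μ hV hb hVb hσ hV0 hV2 hε0 hεb hr0 hr1 hc' hg hC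
    have e1 : ∫ z, (w z * g z) ^ 2 ∂μ = ∫ z, Real.exp (ε * V z) * g z ^ 2 ∂μ :=
      integral_congr_ae (ae_of_all _ fun z => by
        show (w z * g z) ^ 2 = Real.exp (ε * V z) * g z ^ 2
        rw [← hww z]; ring)
    have e2 : ∫ z, w z * g z ∂μ = ∫ z, Real.exp (ε * V z / 2) * g z ∂μ := rfl
    rw [e1, e2, ← hr] at h1
    rw [← hmdef] at h2
    have hsq : 0 ≤ (∫ z, Real.exp (ε * V z / 2) * g z ∂μ) ^ 2 := sq_nonneg _
    nlinarith [h1, h2, hr0, hr1]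
  have hiter := FeynmanKac.integral_sq_sandwich_iterate_le μ (κ h) hSym hPos hwm hwb hm0 hForm hwm hwb n
  have hw2 : ∫ z, w z ^ 2 ∂μ ≤ Real.exp (ε * b) := by
    have hpt : ∀ z, w z ^ 2 ≤ Real.exp (ε * b) := fun z => by
      rw [sq, hww]; exact Real.exp_le_exp.2 (le_abs_self _ |>.trans (hεV z))
    have := integral_mono (FeynmanKac.integrable_of_measurable_of_abs_le μ (hwm.pow_const 2) (B := Real.exp (ε * b))
      fun z => by rw [abs_of_nonneg (sq_nonneg _)]; exact hpt z) (integrable_const _) hpt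
    rwa [integral_const, probReal_univ, one_smul] at this
  have hψ2 : ∫ z, (w z * Sw z) ^ 2 ∂μ ≤ (Real.exp (ε * b) * m ^ n) ^ 2 := by
    have hpt : ∀ z, (w z * Sw z) ^ 2 ≤ Real.exp (ε * b) * Sw z ^ 2 := fun z => by
      rw [mul_pow, sq (w z), hww]
      exact mul_le_mul_of_nonneg_right (Real.exp_le_exp.2 (le_abs_self _ |>.trans (hεV z))) (sq_nonneg _)
    have i1 : Integrable (fun z => (w z * Sw z) ^ 2) μ :=
      FeynmanKac.integrable_of_measurable_of_abs_le μ (hψm.pow_const 2) (B := (Real.exp (ε * b / 2) *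
        ((Real.exp (ε * b / 2) * Real.exp (ε * b / 2)) ^ n * Real.exp (ε * b / 2))) ^ 2) fun z => by
        rw [abs_pow]; exact pow_le_pow_left₀ (abs_nonneg _) (hψb z) 2
    have i2 : Integrable (fun z => Sw z ^ 2) μ :=
      FeynmanKac.integrable_of_measurable_of_abs_le μ (hSm.pow_const 2)
        (B := ((Real.exp (ε * b / 2) * Real.exp (ε * b / 2)) ^ n * Real.exp (ε * b / 2)) ^ 2) fun z => by
        rw [abs_pow]; exact pow_le_pow_left₀ (abs_nonneg _) (hSb z) 2
    calc ∫ z, (w z * Sw z) ^ 2 ∂μ ≤ ∫ z, Real.exp (ε * b) * Sw z ^ 2 ∂μ := integral_mono i1 (i2.const_mul _) hpt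
      _ = Real.exp (ε * b) * ∫ z, Sw z ^ 2 ∂μ := integral_const_mul _ _
      _ ≤ Real.exp (ε * b) * (m ^ (2 * n) * ∫ z, w z ^ 2 ∂μ) := mul_le_mul_of_nonneg_left hiter (Real.exp_pos _).le
      _ ≤ Real.exp (ε * b) * (m ^ (2 * n) * Real.exp (ε * b)) :=
          mul_le_mul_of_nonneg_left (mul_le_mul_of_nonneg_left hw2 (by positivity)) (Real.exp_pos _).le
      _ = (Real.exp (ε * b) * m ^ n) ^ 2 := by ring
  -- step 4: conclude
  have hroot : (∫ z, (w z * Sw z) ^ 2 ∂μ) ^ (1 / (2 : ℝ)) ≤ Real.exp (ε * b) * m ^ n := by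
    rw [← Real.sqrt_eq_rpow]
    calc Real.sqrt (∫ z, (w z * Sw z) ^ 2 ∂μ) ≤ Real.sqrt ((Real.exp (ε * b) * m ^ n) ^ 2) := Real.sqrt_le_sqrt hψ2
      _ = Real.exp (ε * b) * m ^ n := Real.sqrt_sq (by positivity)
  calc ∫ ω, w (U a ω) * Sw (U a ω) ∂P ≤ |∫ ω, w (U a ω) * Sw (U a ω) ∂P| := le_abs_self _
    _ ≤ D * (∫ z, (w z * Sw z) ^ 2 ∂μ) ^ (1 / (2 : ℝ)) := hwarmψ
    _ ≤ D * (Real.exp (ε * b) * m ^ n) := mul_le_mul_of_nonneg_left hroot hD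
    _ = D * Real.exp (θ * h * b) * m ^ n := by rw [hε]; ring

end Summit.QuantumFields.YangMills.Theorems.ColdStartUniversality

end
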